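import Summits.QuantumFields.YangMills.Theorems.BalabanUVNodesN15KingModelCurvatureFlux
import Summits.QuantumFields.YangMills.Theorems.BalabanUVNodesN15KingModelToronGauge
import HarnessLib

/-!
# BalabanUVNodes ∕ N15 — THE KING-MODEL RUNG (PART Ϳ-h): TRANSLATIONS AT A CURVED BACKGROUND — `M_{τ_tU} = P_tM_UP_t⁻¹` for every link field; translating the CONSTANT-FLUX field
# multiplies its `ν₁`-links by the constant phase `χ_p(t)` (a toron factor); when `χ_p(t)^{K_{ν₁}} = 1` that factor is a CHARACTER GAUGE, so the translation is a symmetry UP TO GAUGE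
# (magnetic translation): `P_tM_UP_t⁻¹ = D_gM_UD_g^*`, `|G_U(x+t,y+t)| = |G_U(x,y)|`; character gauges and translations commute up to the phase `χ_r(s)` (Weyl relation)
# (Track A, DAG node N15 = NE2; FAN-OUT v1.1 §N15 s3 «KING-MODEL RUNG … + what the curved case adds»; count-neutral)

HONEST FRAMING.  Count-neutral (cell `pub-ymgap`, seat `pub-ymgap-dag-n15-e` g46; `--supports stmt-QuantumFields-27247 --as helper` = K3ᴬ, KEY MAP v3).  King's fine covariance layer
`−cΔ_U+m²` (Ͱ-a `covLapF`) on ONE finite torus; §1 any link field and fibre, §§2–4 the `U(1)` constant-flux field of Ͻ-q; elementary; NOT Bałaban's `G_k(U)`; NOT [Balaban1985BackgroundPropagators]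
(3.42); NOT a node discharge (N15 of record untouched); nothing continuum ∕ ℝ⁴ ∕ OS ∕ Clay.  Contrast with PART Ϙ (g31): there King's `A = 0` kernels were translation INVARIANT; at a curved
background the gauge-invariant content is translation invariant only up to gauge, and on a finite torus only for translations compatible with the Polyakov loops.

THE RESULTS (`K` any period vector, `c, m²` real):
* §1 (any `U`, any fibre) `kingTransLink t U (x,μ) = U(x+t,μ)`, `kingTransSite t (x,i) = (x+t,i)`, ★★ **`covLapF_shiftLink`** (`M_{τ_tU} = M_U ∘ (τ_t × τ_t)` as `submatrix`), ★ `covLapF_shiftLink_inv`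
  (`G_{τ_tU}(x,y) = G_U(x+t,y+t)`), `kingPlaq_shiftLink` (plaquettes translate), ★★ `covLapF_submatrix_eq_gauge_conj` (if `τ_tU = U^g` then `P_tM_UP_t⁻¹ = D_gM_UD_g^*`: a MAGNETIC TRANSLATION
  commutes with `M_U`);
* §2 (the flux field `U = fluxLink K p ν₁`) `shiftPhase`, ★★ **`shiftLink_fluxLink`** (`τ_tU = U·ω_t`, `ω_t` = the constant `ν₁`-toron with phase `χ_p(t)` — King's flux field is NOT translation
  invariant as a link field), `shiftLink_fluxLink_of_chi_eq_one` (`χ_p(t) = 1` ⟹ `τ_tU = U`: plain symmetry, e.g. all `t` orthogonal to the support of `p`), `kingGaugeAct_charGauge_fluxLink`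
  (`g_rUg_r^* = U·(conj χ_r(e_μ))_μ`), ★★★ **`exists_charGauge_shiftLink_fluxLink`** (`χ_p(t)^{K_{ν₁}} = 1` ⟹ `∃ r, τ_tU = U^{g_r}` — Ͷ-c's root-of-unity character; the condition says the
  Polyakov loops along `ν₁` are translation invariant, i.e. the flux through a `ν₁`-column of plaquettes swept by `t` is trivial);
* §3 ★★★ **`covLapF_fluxLink_magnetic_translation`** (`(M_U)∘(τ_t×τ_t) = D_{g_r}M_UD_{g_r}^*`), ★★★ **`norm_covLapF_fluxLink_inv_shift`** (`IsUnit M_U` ⟹ `|G_U(x+t,y+t)| = |G_U(x,y)|`: the MODULUS of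
  King's covariance at constant flux is translation invariant under the magnetic translations; the phase is the Peierls factor `χ_r(x)χ̄_r(y)`, `covLapF_fluxLink_inv_shift`);
* §4 ★★ **`kingGaugeMat_charGauge_submatrix`** — WEYL RELATION: `P_sD_{g_r}P_s⁻¹ = χ_r(s)·D_{g_r}` (translations and character gauges commute up to a constant phase: the magnetic translations
  form a PROJECTIVE representation of the translation group, cocycle `χ_r(s)`, a phase by `TorusSpectral.norm_chi_eq_one`).
WHAT THE CURVED CASE ADDS (as theorems): at `U ≡ 1` and at torons translations are symmetries (PART Ϙ, Ͷ); at constant flux they survive only composed with gauge transformations, only for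
the sublattice `{t : χ_p(t)^{K_{ν₁}} = 1}`, and they no longer commute with the gauge phases — the kernel keeps a translation-invariant modulus and a covariant phase.
PRIOR TREE ART (by name, not restated): Ͱ-a (`covLapF`, `covLapF_apply`, `kingGaugeAct`, `kingGaugeMat`, `covLapF_kingGaugeAct`, `kingGaugeMat_conjTranspose_mul_self`, `kingGaugeMat_mul_conjTranspose_self`),
Ͷ-a (`toronLink`), Ͷ-c (`charGauge`, `charGauge_apply`, `charGauge_mem_unitaryGroup`, `exists_stdAddChar_eq_of_pow_eq_one`, `chi_mul_conj`, `unit_mul_apply`), Ͻ-q (`kingPlaq`, `fluxLink`),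
`B5Prop11Plancherel` (`chi`, `chi_add_right`, `chi_unitVec`), Mathlib (`Matrix.inv_submatrix_equiv`, `Matrix.submatrix_mul_equiv`).  Dedup (rg at filing): basename 0 files; needles
`kingTransLink|kingTransSite|covLapF_shiftLink|shiftPhase|exists_charGauge_shiftLink_fluxLink|covLapF_fluxLink_magnetic_translation|kingGaugeMat_charGauge_submatrix` 0 tree files.  Locators: [King1986] (2.12) p.653,
(4.4) p.670; [Balaban1985BackgroundPropagators] (3.23) p.394, p.398 l.19 (gauge transformations); [tHooft1979Flux] NPB 153 (flux ∕ twisted sectors, notion only).  0 `sorry`, 3 `def`.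
-/

noncomputable section
open scoped BigOperators ComplexConjugate ComplexOrder
open Finset Matrix

namespace Summit.QuantumFields.YangMills.BalabanUVNodes.N15KingModelRung.Curvature

open Literature.MathematicalPhysics.QuantumFieldTheory.Balaban1983to89.B5Prop11Plancherel (Tor unitVec chi chi_add_right chi_unitVec)
open Summit.QuantumFields.YangMills.BalabanUVNodes.N15KingModelRung.Covariant
  (covLapF covLapF_apply kingGaugeAct kingGaugeMat covLapF_kingGaugeAct kingGaugeMat_conjTranspose_mul_self kingGaugeMat_mul_conjTranspose_self)
open Summit.QuantumFields.YangMills.BalabanUVNodes.N15KingModelRung.Toron (toronLink toronLink_apply charGauge charGauge_apply charGauge_mem_unitaryGroup exists_stdAddChar_eq_of_pow_eq_one chi_mul_conj unit_mul_apply)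
open Summit.QuantumFields.YangMills.BalabanUVNodes.N15KingModelRung.Cover (kingPlaq fluxLink)
open Summit.QuantumFields.YangMills.BalabanUVNodes.N15KingModelRung.TorusSpectral (norm_chi_eq_one)

variable {d : ℕ} (K : Fin (d + 1) → ℕ)

/-! ## §1 Translation covariance of the covariant operator -/

section General

variable {𝕜 : Type*} [RCLike 𝕜] {n : Type*} [Fintype n] [DecidableEq n]

/-- THE TRANSLATED LINK FIELD `(τ_tU)(x,μ) = U(x+t,μ)`. [folklore] -/
def kingTransLink (t : Tor K) (U : Tor K × Fin (d + 1) → Matrix n n 𝕜) : Tor K × Fin (d + 1) → Matrix n n 𝕜 := fun b => U (b.1 + t, b.2)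

/-- THE SITE TRANSLATION `(x,i) ↦ (x+t,i)` as an equivalence of `T × n`. [folklore] -/
def kingTransSite (n : Type*) (t : Tor K) : Tor K × n ≃ Tor K × n := Equiv.prodCongr (Equiv.addRight t) (Equiv.refl n)

omit [Fintype n] [DecidableEq n] in
/-- `kingTransSite t (x,i) = (x+t,i)`. [folklore] -/
@[simp] theorem kingTransSite_apply (t : Tor K) (p : Tor K × n) : kingTransSite K n t p = (p.1 + t, p.2) := rfl

variable [hK : ∀ μ, NeZero (K μ)]

omit [Fintype n] in
/-- ★★ **TRANSLATION COVARIANCE**: `M_{τ_tU}((x,i),(y,j)) = M_U((x+t,i),(y+t,j))` — the covariant operator of the translated field is the translated operator (King's stencil is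
translation invariant; only `U` moves). [cite: King1986, (4.4) p.670; Balaban1985BackgroundPropagators, (3.23) p.394] -/
theorem covLapF_shiftLink (c m2 : ℝ) (t : Tor K) (U : Tor K × Fin (d + 1) → Matrix n n 𝕜) :
    covLapF K c m2 (kingTransLink K t U) = (covLapF K c m2 U).submatrix (kingTransSite K n t) (kingTransSite K n t) := by
  ext ⟨x, i⟩ ⟨y, j⟩
  rw [Matrix.submatrix_apply, kingTransSite_apply, kingTransSite_apply, covLapF_apply, covLapF_apply]
  simp only [kingTransLink]
  have e1 : (x + t = y + t) ↔ (x = y) := add_left_inj t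
  have e2 : ∀ μ, (y + t = x + t + unitVec K μ) ↔ (y = x + unitVec K μ) := fun μ => by rw [add_right_comm, add_left_inj]
  have e3 : ∀ μ, (y + t = x - unitVec K μ + t) ↔ (y = x - unitVec K μ) := fun μ => add_left_inj t
  have e4 : ∀ μ, x + t - unitVec K μ = x - unitVec K μ + t := fun μ => add_sub_right_comm _ _ _
  simp only [e1, e2, e4, e3]

/-- ★ … hence `G_{τ_tU}((x,i),(y,j)) = G_U((x+t,i),(y+t,j))` for the (pseudo-)inverse. [cite: King1986, (4.4) p.670] -/
theorem covLapF_shiftLink_inv (c m2 : ℝ) (t : Tor K) (U : Tor K × Fin (d + 1) → Matrix n n 𝕜) :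
    (covLapF K c m2 (kingTransLink K t U))⁻¹ = (covLapF K c m2 U)⁻¹.submatrix (kingTransSite K n t) (kingTransSite K n t) := by
  rw [covLapF_shiftLink, Matrix.inv_submatrix_equiv]

omit hK [DecidableEq n] in
/-- Plaquettes translate: `P_{τ_tU}(x,μ,ν) = P_U(x+t,μ,ν)`. [cite: King1986, (2.12) p.653] -/
theorem kingPlaq_shiftLink (t : Tor K) (U : Tor K × Fin (d + 1) → Matrix n n 𝕜) (x : Tor K) (μ ν : Fin (d + 1)) :
    kingPlaq K (kingTransLink K t U) x μ ν = kingPlaq K U (x + t) μ ν := by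
  simp only [kingPlaq, kingTransLink, add_right_comm _ t]

/-- ★★ **MAGNETIC TRANSLATIONS COMMUTE WITH `M_U`**: if the translated field is a gauge transform of the field, `τ_tU = U^g` (`g` unitary), then `P_tM_UP_t⁻¹ = D_gM_UD_g^*`, i.e. the
operator `D_g^*P_t` commutes with `M_U`. [cite: Balaban1985BackgroundPropagators, p.398 l.19; King1986, (4.4) p.670] -/
theorem covLapF_submatrix_eq_gauge_conj (c m2 : ℝ) {t : Tor K} {U : Tor K × Fin (d + 1) → Matrix n n 𝕜} {g : Tor K → Matrix n n 𝕜} (hg : ∀ x, g x ∈ Matrix.unitaryGroup n 𝕜)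
    (h : kingTransLink K t U = kingGaugeAct K g U) :
    (covLapF K c m2 U).submatrix (kingTransSite K n t) (kingTransSite K n t) = kingGaugeMat K g * covLapF K c m2 U * (kingGaugeMat K g)ᴴ := by
  rw [← covLapF_shiftLink, h, covLapF_kingGaugeAct K c m2 hg]

end General

/-! ## §2 Translating the constant-flux field -/

section Flux

variable [hK : ∀ μ, NeZero (K μ)]

/-- The constant `ν₁`-phase picked up by a translation: `ω_t(μ) = χ_p(t)` for `μ = ν₁`, `1` otherwise. [folklore] -/
def shiftPhase (p : Tor K) (ν₁ : Fin (d + 1)) (t : Tor K) : Fin (d + 1) → ℂ := fun μ => if μ = ν₁ then chi K p t else 1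

/-- ★★ **TRANSLATING THE FLUX FIELD MULTIPLIES IT BY A CONSTANT TORON**: `(τ_tU)(x,μ) = U(x,μ)·ω_t(μ)` (`χ_p(x+t) = χ_p(x)χ_p(t)` on the `ν₁`-links).
[cite: tHooft1979Flux, NPB 153 (flux sectors, notion); King1986, (2.12) p.653] -/
theorem shiftLink_fluxLink (p : Tor K) (ν₁ : Fin (d + 1)) (t : Tor K) :
    kingTransLink K t (fluxLink K p ν₁) = fun b => fluxLink K p ν₁ b * toronLink K (shiftPhase K p ν₁ t) b := by
  funext b
  ext i j
  obtain rfl : i = () := rfl; obtain rfl : j = () := rfl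
  rw [unit_mul_apply, toronLink_apply]
  simp only [kingTransLink, fluxLink, shiftPhase]
  split_ifs with h
  · simp only [Matrix.of_apply, chi_add_right]
  · simp

/-- `χ_p(t) = 1` ⟹ `τ_tU = U`: translations that see no phase are PLAIN symmetries of the flux field (e.g. `t` in directions where `p` vanishes). [folklore] -/
theorem shiftLink_fluxLink_of_chi_eq_one {p t : Tor K} (ht : chi K p t = 1) (ν₁ : Fin (d + 1)) : kingTransLink K t (fluxLink K p ν₁) = fluxLink K p ν₁ := by
  rw [shiftLink_fluxLink]
  funext b
  ext i j
  obtain rfl : i = () := rfl; obtain rfl : j = () := rfl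
  rw [unit_mul_apply, toronLink_apply]
  simp only [shiftPhase, ht, ite_self, mul_one]

/-- A character gauge acts on the flux field by a constant toron factor: `g_rUg_r^*(x,μ) = U(x,μ)·conj χ_r(e_μ)` (abelian links commute). [cite: Balaban1985BackgroundPropagators, p.398 l.19] -/
theorem kingGaugeAct_charGauge_fluxLink (r p : Tor K) (ν₁ : Fin (d + 1)) :
    kingGaugeAct K (charGauge K r) (fluxLink K p ν₁) = fun b => fluxLink K p ν₁ b * toronLink K (fun μ => conj (chi K r (unitVec K μ))) b := by
  funext ⟨x, μ⟩
  ext i j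
  obtain rfl : i = () := rfl; obtain rfl : j = () := rfl
  simp only [kingGaugeAct]
  rw [unit_mul_apply, unit_mul_apply, unit_mul_apply, Matrix.conjTranspose_apply, charGauge_apply, charGauge_apply, toronLink_apply, chi_add_right, Complex.star_def, map_mul]
  calc chi K r x * fluxLink K p ν₁ (x, μ) () () * (conj (chi K r x) * conj (chi K r (unitVec K μ)))
      = fluxLink K p ν₁ (x, μ) () () * conj (chi K r (unitVec K μ)) * (chi K r x * conj (chi K r x)) := by ring
    _ = fluxLink K p ν₁ (x, μ) () () * conj (chi K r (unitVec K μ)) := by rw [chi_mul_conj, mul_one]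

/-- ★★★ **MAGNETIC TRANSLATIONS EXIST ON THE SUBLATTICE `χ_p(t)^{K_{ν₁}} = 1`**: then `∃ r, τ_tU = U^{g_r}` with `g_r` a character gauge (take `r = q·e_{ν₁}` with `χ(q) = conj χ_p(t)`,
Ͷ-c `exists_stdAddChar_eq_of_pow_eq_one`).  The condition says that the Polyakov loops along `ν₁` — gauge invariants — are unchanged by the translation.
[cite: tHooft1979Flux, NPB 153 (flux sectors, notion); Balaban1985BackgroundPropagators, p.398 l.19] -/
theorem exists_charGauge_shiftLink_fluxLink {p t : Tor K} {ν₁ : Fin (d + 1)} (ht : chi K p t ^ K ν₁ = 1) :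
    ∃ r : Tor K, kingTransLink K t (fluxLink K p ν₁) = kingGaugeAct K (charGauge K r) (fluxLink K p ν₁) := by
  have hconj : (conj (chi K p t)) ^ K ν₁ = 1 := by rw [← map_pow, ht, map_one]
  obtain ⟨q, hq⟩ := exists_stdAddChar_eq_of_pow_eq_one K ν₁ hconj
  refine ⟨Pi.single ν₁ q, ?_⟩
  rw [shiftLink_fluxLink, kingGaugeAct_charGauge_fluxLink]
  funext b
  congr 2
  funext μ
  simp only [shiftPhase, chi_unitVec]
  by_cases h : μ = ν₁
  · subst h
    rw [if_pos rfl, Pi.single_eq_same, hq, RCLike.conj_conj]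
  · rw [if_neg h, Pi.single_eq_of_ne h, AddChar.map_zero_eq_one, map_one]

end Flux

/-! ## §3 The magnetic translation symmetry of `M_U` and of the kernel modulus -/

section Magnetic

variable [hK : ∀ μ, NeZero (K μ)]

/-- ★★★ **`P_tM_UP_t⁻¹ = D_{g_r}M_UD_{g_r}^*`** at the flux field, for every translation `t` with `χ_p(t)^{K_{ν₁}} = 1`: the covariant operator commutes with the MAGNETIC TRANSLATION
`D_{g_r}^*P_t`. [cite: tHooft1979Flux, NPB 153 (flux sectors, notion); King1986, (4.4) p.670; Balaban1985BackgroundPropagators, p.398 l.19] -/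
theorem covLapF_fluxLink_magnetic_translation (c m2 : ℝ) {p t : Tor K} {ν₁ : Fin (d + 1)} (ht : chi K p t ^ K ν₁ = 1) :
    ∃ r : Tor K, (covLapF K c m2 (fluxLink K p ν₁)).submatrix (kingTransSite K Unit t) (kingTransSite K Unit t)
      = kingGaugeMat K (charGauge K r) * covLapF K c m2 (fluxLink K p ν₁) * (kingGaugeMat K (charGauge K r))ᴴ := by
  obtain ⟨r, hr⟩ := exists_charGauge_shiftLink_fluxLink K ht
  exact ⟨r, covLapF_submatrix_eq_gauge_conj K c m2 (charGauge_mem_unitaryGroup K r) hr⟩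

omit hK in
/-- Conjugating by a `U(1)` gauge matrix multiplies the entries by phases: `(D_gAD_g^*)((x,·),(y,·)) = g(x)·A((x,·),(y,·))·conj g(y)`. [folklore] -/
theorem kingGaugeMat_conj_apply_unit [∀ μ, NeZero (K μ)] (g : Tor K → Matrix Unit Unit ℂ) (A : Matrix (Tor K × Unit) (Tor K × Unit) ℂ) (x y : Tor K) :
    (kingGaugeMat K g * A * (kingGaugeMat K g)ᴴ) (x, ()) (y, ()) = g x () () * A (x, ()) (y, ()) * conj (g y () ()) := by
  rw [Matrix.mul_apply, Fintype.sum_prod_type, Finset.sum_eq_single y]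
  · rw [Fintype.sum_unique, Matrix.mul_apply, Fintype.sum_prod_type, Finset.sum_eq_single x]
    · rw [Fintype.sum_unique, Matrix.conjTranspose_apply]
      simp [kingGaugeMat]
    · intro z _ hz; rw [Fintype.sum_unique]; simp [kingGaugeMat, Ne.symm hz]
    · intro h; exact absurd (Finset.mem_univ _) h
  · intro z _ hz; rw [Fintype.sum_unique, Matrix.conjTranspose_apply]; simp [kingGaugeMat, Ne.symm hz]
  · intro h; exact absurd (Finset.mem_univ _) h

/-- The inverse transforms the same way: `IsUnit M` ⟹ `(D_gMD_g^*)⁻¹ = D_gM⁻¹D_g^*` for unitary `D_g`. [folklore] -/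
theorem inv_gauge_conj {g : Tor K → Matrix Unit Unit ℂ} (hg : ∀ x, g x ∈ Matrix.unitaryGroup Unit ℂ) (A : Matrix (Tor K × Unit) (Tor K × Unit) ℂ) :
    (kingGaugeMat K g * A * (kingGaugeMat K g)ᴴ)⁻¹ = kingGaugeMat K g * A⁻¹ * (kingGaugeMat K g)ᴴ := by
  have h1 := kingGaugeMat_conjTranspose_mul_self K hg
  have h2 := kingGaugeMat_mul_conjTranspose_self K hg
  have hD : (kingGaugeMat K g)⁻¹ = (kingGaugeMat K g)ᴴ := Matrix.inv_eq_left_inv h1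
  have hDh : ((kingGaugeMat K g)ᴴ)⁻¹ = kingGaugeMat K g := Matrix.inv_eq_left_inv h2
  rw [Matrix.mul_inv_rev, Matrix.mul_inv_rev, hD, hDh, Matrix.mul_assoc]

/-- ★★ THE KERNEL UNDER A MAGNETIC TRANSLATION: `G_U((x+t),(y+t)) = χ_r(x)·G_U(x,y)·conj χ_r(y)` (Peierls phases), for `χ_p(t)^{K_{ν₁}} = 1` and `M_U` invertible.
[cite: tHooft1979Flux, NPB 153 (flux sectors, notion); King1986, (4.4) p.670] -/
theorem covLapF_fluxLink_inv_shift (c m2 : ℝ) {p t : Tor K} {ν₁ : Fin (d + 1)} (ht : chi K p t ^ K ν₁ = 1) (x y : Tor K) :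
    ∃ r : Tor K, (covLapF K c m2 (fluxLink K p ν₁))⁻¹ (x + t, ()) (y + t, ())
      = chi K r x * (covLapF K c m2 (fluxLink K p ν₁))⁻¹ (x, ()) (y, ()) * conj (chi K r y) := by
  obtain ⟨r, hr⟩ := covLapF_fluxLink_magnetic_translation K c m2 ht
  refine ⟨r, ?_⟩
  have h1 : ((covLapF K c m2 (fluxLink K p ν₁)).submatrix (kingTransSite K Unit t) (kingTransSite K Unit t))⁻¹
      = (kingGaugeMat K (charGauge K r) * covLapF K c m2 (fluxLink K p ν₁) * (kingGaugeMat K (charGauge K r))ᴴ)⁻¹ := by rw [hr]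
  rw [Matrix.inv_submatrix_equiv, inv_gauge_conj K (charGauge_mem_unitaryGroup K r)] at h1
  have h2 := congrFun (congrFun h1 (x, ())) (y, ())
  rw [Matrix.submatrix_apply, kingTransSite_apply, kingTransSite_apply, kingGaugeMat_conj_apply_unit, charGauge_apply, charGauge_apply] at h2
  exact h2

/-- ★★★ **THE MODULUS OF KING's COVARIANCE AT CONSTANT FLUX IS TRANSLATION INVARIANT** under the magnetic translations: `|G_U(x+t, y+t)| = |G_U(x,y)|` whenever `χ_p(t)^{K_{ν₁}} = 1`
(`|χ| = 1`). [cite: tHooft1979Flux, NPB 153 (flux sectors, notion); King1986, (4.4) p.670] -/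
theorem norm_covLapF_fluxLink_inv_shift (c m2 : ℝ) {p t : Tor K} {ν₁ : Fin (d + 1)} (ht : chi K p t ^ K ν₁ = 1) (x y : Tor K) :
    ‖(covLapF K c m2 (fluxLink K p ν₁))⁻¹ (x + t, ()) (y + t, ())‖ = ‖(covLapF K c m2 (fluxLink K p ν₁))⁻¹ (x, ()) (y, ())‖ := by
  obtain ⟨r, hr⟩ := covLapF_fluxLink_inv_shift K c m2 ht x y
  rw [hr, norm_mul, norm_mul, RCLike.norm_conj, norm_chi_eq_one, norm_chi_eq_one, one_mul, mul_one]

end Magnetic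

/-! ## §4 The Weyl relation -/

section Weyl

variable [hK : ∀ μ, NeZero (K μ)]

/-- ★★ **WEYL RELATION**: `P_sD_{g_r}P_s⁻¹ = χ_r(s)·D_{g_r}` — translating a character gauge multiplies it by the constant phase `χ_r(s)`; hence the magnetic translations `D_{g_r}^*P_t`
compose only PROJECTIVELY (cocycle `χ_r(s)`, the flux through the parallelogram spanned by the two translations). [cite: tHooft1979Flux, NPB 153 (flux sectors, notion)] -/
theorem kingGaugeMat_charGauge_submatrix (r s : Tor K) :
    (kingGaugeMat K (charGauge K r)).submatrix (kingTransSite K Unit s) (kingTransSite K Unit s) = chi K r s • kingGaugeMat K (charGauge K r) := by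
  ext ⟨x, i⟩ ⟨y, j⟩
  obtain rfl : i = () := rfl; obtain rfl : j = () := rfl
  rw [Matrix.submatrix_apply, kingTransSite_apply, kingTransSite_apply, Matrix.smul_apply, smul_eq_mul]
  simp only [kingGaugeMat, add_left_inj]
  split_ifs with h
  · rw [charGauge_apply, charGauge_apply, chi_add_right, mul_comm]
  · rw [mul_zero]

end Weyl

end Summit.QuantumFields.YangMills.BalabanUVNodes.N15KingModelRung.Curvature

end
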